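import Summits.Parity.BatemanHorn.Theorems.SoloInformedThinComparison
import HarnessLib

/-!
# Thin sequences vs. Type-II information, VIII: an exceptional set of primes

Part of the `SoloInformedThin*` series.  `SoloInformedThinComparison` proves the Type-II void for a
support of size `x^{1−c}` against any comparison sequence `b`, `0 ≤ b ≤ x^η`, which puts mass
`≥ x/(4p)` on the multiples of EVERY prime `p` of the Type-II window.  Ford–Maynard's comparison
sequences `b_n = (xq/2)/(yφ(q)) · 1_{x−y<n≤x, (n,q)=1}` (Lemma 4.6, any modulus `q ≤ x²`) vanish
on the multiples of the primes dividing `q`, which may lie in the window.  Here the mass condition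
is only imposed outside an arbitrary exceptional set `Q` of primes with `#Q ≤ (log x)²`; the proof
discards the primes of `Q` from the dyadic block `(M, 2M]`, `M ≍ x^{θ'}` with `θ < θ' < θ + ν`,
`θ' + η < c`, where `#{p ∈ (M, 2M]} ≫ M/log M` dominates `(log x)²`.

* `eventually_not_typeII_of_sparse_cmp_except` — exceptional set `Q`, `#Q ≤ (log x)²`;
* `eventually_not_typeII_of_sparse_cmp_coprime` — the `(n, q) = 1` twist: `0 < q ≤ x²`, mass only on
  multiples of window primes `p ∤ q`.

References: [cite: FordMaynard2024PrimeSieves, §2.4 (p. 7, first family)]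
[cite: FordMaynard2024PrimeSieves, §4.2 (Lemma 4.6)] [cite: FordMaynard2024PrimeSieves, §1 (II)].
-/

noncomputable section

open Filter Finset Real

namespace Summit.Parity.BatemanHorn.Theorems

open Literature.Barriers.Parity.FordMaynard (TypeII eventually_mul_rpow_le_rpow)

set_option maxHeartbeats 400000 in
/-- **No Type-II information below the density — general comparison with an exceptional set
of primes.**  As `eventually_not_typeII_of_sparse_cmp`, but the comparison sequence `b` is only
required to put mass `≥ x/(4p)` on the multiples of the window primes `p ∉ Q`, for an arbitrary
exceptional set `Q` with `#Q ≤ (log x)²` — e.g. the prime divisors of a modulus `q ≤ x²`, which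
covers Ford–Maynard's comparison sequences `b_n = (xq/2)/(yφ(q))·1_{x−y<n≤x, (n,q)=1}`
(Lemma 4.6).  Let `0 ≤ θ`, `0 ≤ η`, `θ + η < c ≤ 1`, `ν > 0`, `B > 1`; then for all large `x` no
real `a` with at most `x^{1−c}` non-zero values on `(x/2, x]` and no such `b` with `0 ≤ b ≤ x^η`
have `w = a − b` satisfying (II) in `[θ, θ + ν]`.
[cite: FordMaynard2024PrimeSieves, §2.4] [cite: FordMaynard2024PrimeSieves, §4.2 (Lemma 4.6)] -/
theorem eventually_not_typeII_of_sparse_cmp_except {c θ ν B η : ℝ} (hθ : 0 ≤ θ) (hη : 0 ≤ η)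
    (hθc : θ + η < c) (hc1 : c ≤ 1) (hν : 0 < ν) (hB : 1 < B) :
    ∀ᶠ x : ℝ in atTop, ∀ (a b : ℕ → ℝ) (A Q : Finset ℕ), (A.card : ℝ) ≤ x ^ (1 - c) →
      (∀ v : ℕ, x / 2 < (v : ℝ) → (v : ℝ) ≤ x → a v ≠ 0 → v ∈ A) →
      (∀ n, 0 ≤ b n) → (∀ n, b n ≤ x ^ η) → (Q.card : ℝ) ≤ Real.log x ^ 2 →
      (∀ p : ℕ, p.Prime → p ∉ Q → (x / 2) ^ θ < (p : ℝ) → (p : ℝ) ≤ x ^ (θ + ν) →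
        x / (4 * p) ≤ ∑ n ∈ (Icc 1 ⌊x⌋₊).filter
          (fun n : ℕ => x / 2 < (p * n : ℝ) ∧ (p * n : ℝ) ≤ x), b (p * n)) →
      ¬ TypeII (fun n : ℕ => a n - b n) x θ ν B := by
  obtain ⟨K, hK1, hK⟩ := exists_card_primes_Ioc_two_mul_ge
  have hK0 : 0 < K := by linarith
  -- an exponent `θ'` strictly inside the window with `θ' + η < c`, `θ' > 0`
  set μ : ℝ := min ν (c - θ - η) with hμdef
  have hμν : μ ≤ ν := min_le_left _ _
  have hμc : μ ≤ c - θ - η := min_le_right _ _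
  have hμ0 : 0 < μ := lt_min hν (by linarith)
  set θ' : ℝ := θ + μ / 2 with hθ'def
  have hθθ' : θ ≤ θ' := by rw [hθ'def]; linarith
  have hθ'0 : 0 < θ' := by rw [hθ'def]; linarith
  have hθ'ν : θ' < θ + ν := by rw [hθ'def]; linarith
  have hθ'c : θ' + η < c := by rw [hθ'def]; linarith
  have hδ : 0 < (c - θ' - η) / 2 := by linarith
  have hθ'4 : 0 < θ' / 4 := by linarith
  filter_upwards [eventually_ge_atTop (4 : ℝ),
    eventually_mul_rpow_le_rpow 6 hθ'ν,
    eventually_mul_rpow_le_rpow 48 (by linarith : θ' < 1),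
    eventually_mul_rpow_le_rpow 192
      (by linarith : θ' + η + (1 - c) + (c - θ' - η) / 2 < 1),
    (isLittleO_log_rpow_atTop hδ).bound one_pos,
    (isLittleO_log_rpow_atTop hθ'4).bound one_pos,
    eventually_mul_rpow_le_rpow (4 * K) (by linarith : θ' / 4 + θ' / 4 + θ' / 4 < θ'),
    ((tendsto_rpow_atTop (by linarith : 0 < B - 1)).comp
      Real.tendsto_log_atTop).eventually_gt_atTop (8 * (4 * K))]
    with x hx4 e1 e2 e3 elog elog2 e5 e4 a b A Q hA hcov hb0 hbη hQ hbm hII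
  rw [Real.rpow_one] at e2 e3
  have hx0 : 0 < x := by linarith
  have hx1 : 1 ≤ x := by linarith
  have hlx : 0 ≤ Real.log x := Real.log_nonneg hx1
  have hlogle : Real.log x ≤ x ^ ((c - θ' - η) / 2) := by
    have := elog
    simp only [one_mul, Real.norm_eq_abs] at this
    rwa [abs_of_nonneg hlx, abs_of_nonneg (Real.rpow_nonneg hx0.le _)] at this
  have hlogle2 : Real.log x ≤ x ^ (θ' / 4) := by
    have := elog2
    simp only [one_mul, Real.norm_eq_abs] at this
    rwa [abs_of_nonneg hlx, abs_of_nonneg (Real.rpow_nonneg hx0.le _)] at this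
  have e4' : 8 * (4 * K) < Real.log x ^ (B - 1) := by simpa using e4
  -- the scale `M ≍ x^θ'` and the primes `S` of `(M, 2M]` outside `Q`
  set M : ℕ := ⌊x ^ θ'⌋₊ + 2 with hMdef
  have hM2 : 2 ≤ M := by omega
  have hM2r : (2 : ℝ) ≤ M := by exact_mod_cast hM2
  have hMθ' : x ^ θ' < M := by
    have := Nat.lt_floor_add_one (x ^ θ')
    push_cast [hMdef]
    linarith
  have hMθ : (x / 2) ^ θ < M := by
    have h1 : (x / 2) ^ θ ≤ x ^ θ := Real.rpow_le_rpow (by linarith) (by linarith) hθ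
    have h2 : x ^ θ ≤ x ^ θ' := Real.rpow_le_rpow_of_exponent_le hx1 hθθ'
    linarith
  have hxθ1 : 1 ≤ x ^ θ' := Real.one_le_rpow hx1 hθ'0.le
  have hMle : (M : ℝ) ≤ 3 * x ^ θ' := by
    have h1 : (⌊x ^ θ'⌋₊ : ℝ) ≤ x ^ θ' := Nat.floor_le (Real.rpow_nonneg hx0.le _)
    push_cast [hMdef]
    linarith
  set P : Finset ℕ := (Ioc M (2 * M)).filter Nat.Prime with hPdef
  set S : Finset ℕ := P.filter (fun p : ℕ => p ∉ Q) with hSdef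
  have hSP : S ⊆ P := by rw [hSdef]; exact filter_subset _ _
  have hSprop : ∀ p ∈ S, p.Prime ∧ (M : ℝ) < p ∧ (x / 2) ^ θ < (p : ℝ) ∧
      (p : ℝ) ≤ x ^ (θ + ν) := by
    intro p hp
    have hp' := hSP hp
    rw [hPdef, mem_filter, mem_Ioc] at hp'
    obtain ⟨⟨hMp, hp2M⟩, hpr⟩ := hp'
    have hMp' : (M : ℝ) < p := by exact_mod_cast hMp
    have hp2M' : (p : ℝ) ≤ 2 * M := by exact_mod_cast hp2M
    exact ⟨hpr, hMp', hMθ.trans hMp', by linarith⟩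
  have hSQ : ∀ p ∈ S, p ∉ Q := fun p hp => by
    have := hp; rw [hSdef, Finset.mem_filter] at this; exact this.2
  have hmain := typeII_sparse_le_cmp (by linarith) hx1 (by linarith : (1 : ℝ) < M) S A hSprop
    hcov hb0 hbη hII
  -- lower bounds
  have hL : Real.log x / Real.log M ≤ 2 * Real.log x := by
    have hlogM : Real.log 2 ≤ Real.log M := Real.log_le_log two_pos hM2r
    have hl2 := Real.log_two_gt_d9
    rw [div_le_iff₀ (by linarith)]
    nlinarith
  have hcardP := hK M (by omega)
  have h8M : 16 * (M : ℝ) ≤ x := by linarith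
  have h2Mx : 2 * (M : ℝ) ≤ x := by linarith
  have hlog2M0 : 0 < Real.log (2 * M) := Real.log_pos (by linarith)
  have hlog2M : Real.log (2 * M) ≤ Real.log x := Real.log_le_log (by positivity) h2Mx
  have hlx0 : 0 < Real.log x := by linarith
  -- `#S ≥ #P − #Q ≥ M/(K log 2M) − (log x)² ≥ M/(2K log 2M)`
  have hcardS : (M : ℝ) / (2 * K * Real.log (2 * M)) ≤ S.card := by
    have hsplit := Finset.card_filter_add_card_filter_not (s := P) (fun p : ℕ => p ∈ Q)
    have hPQ : (P.filter (fun p : ℕ => p ∈ Q)).card ≤ Q.card :=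
      card_le_card (fun p hp => (Finset.mem_filter.mp hp).2)
    have hS' : ((P.filter (fun p : ℕ => p ∈ Q)).card : ℝ) + S.card = P.card := by
      rw [hSdef]; exact_mod_cast hsplit
    have hPQ' : ((P.filter (fun p : ℕ => p ∈ Q)).card : ℝ) ≤ Q.card := by exact_mod_cast hPQ
    have hP' : (M : ℝ) / (K * Real.log (2 * M)) ≤ P.card := by rw [hPdef]; exact hcardP
    -- `(log x)^2 · 2K log(2M) ≤ 2K (log x)^3 ≤ 2K x^{3θ'/4} ≤ x^θ'/2 ≤ M`
    have hl3 : Real.log x ^ 2 * (2 * K * Real.log (2 * M)) ≤ M := by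
      have h1 : Real.log x ^ 2 * (2 * K * Real.log (2 * M)) ≤
          2 * K * (Real.log x * Real.log x * Real.log x) := by
        have hB2 : 2 * K * Real.log x ^ 2 * Real.log (2 * M) ≤
            2 * K * Real.log x ^ 2 * Real.log x :=
          mul_le_mul_of_nonneg_left hlog2M (by positivity)
        have hA2 : Real.log x ^ 2 * (2 * K * Real.log (2 * M)) =
            2 * K * Real.log x ^ 2 * Real.log (2 * M) := by ring
        have hC2 : 2 * K * (Real.log x * Real.log x * Real.log x) =
            2 * K * Real.log x ^ 2 * Real.log x := by ring
        rw [hA2, hC2]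
        exact hB2
      have h2 : Real.log x * Real.log x * Real.log x ≤
          x ^ (θ' / 4) * x ^ (θ' / 4) * x ^ (θ' / 4) :=
        mul_le_mul (mul_le_mul hlogle2 hlogle2 hlx (Real.rpow_nonneg hx0.le _)) hlogle2 hlx
          (by positivity)
      have h3 : x ^ (θ' / 4) * x ^ (θ' / 4) * x ^ (θ' / 4) = x ^ (θ' / 4 + θ' / 4 + θ' / 4) := by
        rw [← Real.rpow_add hx0, ← Real.rpow_add hx0]
      rw [h3] at h2
      have h4 := mul_le_mul_of_nonneg_left h2 (by positivity : (0 : ℝ) ≤ 2 * K)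
      linarith
    have hQ' : Real.log x ^ 2 ≤ (M : ℝ) / (2 * K * Real.log (2 * M)) := by
      rw [le_div_iff₀ (by positivity)]; exact hl3
    have hid : (M : ℝ) / (K * Real.log (2 * M)) =
        2 * ((M : ℝ) / (2 * K * Real.log (2 * M))) := by
      field_simp
    linarith
  have hsum : (S.card : ℝ) * (x / (8 * M)) ≤ ∑ p ∈ S, ∑ n ∈ (Icc 1 ⌊x⌋₊).filter
      (fun n : ℕ => x / 2 < (p * n : ℝ) ∧ (p * n : ℝ) ≤ x), b (p * n) := by
    rw [← nsmul_eq_mul, ← sum_const]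
    refine sum_le_sum fun p hp => ?_
    have hp2M : (p : ℝ) ≤ 2 * M := by
      have := hSP hp; rw [hPdef, mem_filter, mem_Ioc] at this; exact_mod_cast this.1.2
    obtain ⟨hpr, _, hpθ, hpθν⟩ := hSprop p hp
    have hp0 : (0 : ℝ) < p := by exact_mod_cast hpr.pos
    have : x / (8 * M) ≤ x / (4 * p) :=
      div_le_div_of_nonneg_left hx0.le (by positivity) (by linarith)
    exact this.trans (hbm p hpr (hSQ p hp) hpθ hpθν)
  have hX : (S.card : ℝ) * (x ^ η * (A.card * (Real.log x / Real.log M))) ≤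
      S.card * (x ^ η * (x ^ (1 - c) * (2 * Real.log x))) := by
    apply mul_le_mul_of_nonneg_left _ (Nat.cast_nonneg _)
    apply mul_le_mul_of_nonneg_left _ (Real.rpow_nonneg hx0.le _)
    exact mul_le_mul hA hL (div_nonneg hlx (Real.log_nonneg (by linarith)))
      (Real.rpow_nonneg hx0.le _)
  have h16M : 16 * (M : ℝ) * (2 * x ^ η * x ^ (1 - c) * Real.log x) ≤ x / 2 := by
    have hnn1 : 0 ≤ x ^ (1 - c) := Real.rpow_nonneg hx0.le _
    have hnn2 : 0 ≤ x ^ η := Real.rpow_nonneg hx0.le _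
    have hprod : x ^ θ' * x ^ η * x ^ (1 - c) * x ^ ((c - θ' - η) / 2) =
        x ^ (θ' + η + (1 - c) + (c - θ' - η) / 2) := by
      rw [← Real.rpow_add hx0, ← Real.rpow_add hx0, ← Real.rpow_add hx0]
    have t2a : (M : ℝ) * (x ^ η * x ^ (1 - c) * Real.log x) ≤
        3 * x ^ θ' * (x ^ η * x ^ (1 - c) * x ^ ((c - θ' - η) / 2)) :=
      mul_le_mul hMle (mul_le_mul_of_nonneg_left hlogle (by positivity)) (by positivity)
        (by positivity)
    rw [← hprod] at e3
    have : 3 * x ^ θ' * (x ^ η * x ^ (1 - c) * x ^ ((c - θ' - η) / 2)) =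
        3 * (x ^ θ' * x ^ η * x ^ (1 - c) * x ^ ((c - θ' - η) / 2)) := by ring
    rw [this] at t2a
    have : 16 * (M : ℝ) * (2 * x ^ η * x ^ (1 - c) * Real.log x) =
        32 * ((M : ℝ) * (x ^ η * x ^ (1 - c) * Real.log x)) := by ring
    rw [this]
    linarith
  have hTlow : x / (8 * (4 * K) * Real.log x) ≤ (S.card : ℝ) * (x / (16 * M)) := by
    have hMK : (M : ℝ) / (2 * K * Real.log x) ≤ S.card :=
      le_trans (div_le_div_of_nonneg_left (by positivity) (by positivity)
        (mul_le_mul_of_nonneg_left hlog2M (by positivity))) hcardS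
    have hMne : (M : ℝ) ≠ 0 := by positivity
    have hlxne : Real.log x ≠ 0 := hlx0.ne'
    have hKne : K ≠ 0 := hK0.ne'
    calc x / (8 * (4 * K) * Real.log x)
          = (M : ℝ) / (2 * K * Real.log x) * (x / (16 * M)) := by
          field_simp
          try ring
      _ ≤ S.card * (x / (16 * M)) := mul_le_mul_of_nonneg_right hMK (by positivity)
  have hmid : (S.card : ℝ) * (x / (16 * M)) ≤
      S.card * (x / (8 * M) - x ^ η * (x ^ (1 - c) * (2 * Real.log x))) := by
    apply mul_le_mul_of_nonneg_left _ (Nat.cast_nonneg _)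
    have hM16 : (0 : ℝ) < 16 * M := by positivity
    have h81 : 2 * x ^ η * x ^ (1 - c) * Real.log x ≤ x / (2 * (16 * M)) := by
      rw [le_div_iff₀ (by positivity)]; linarith
    have hMne : (M : ℝ) ≠ 0 := by positivity
    have h84 : x / (8 * M) = 2 * (x / (16 * M)) := by
      field_simp; ring
    have h85 : x / (2 * (16 * M)) = (x / (16 * M)) / 2 := by
      field_simp
    have : x ^ η * (x ^ (1 - c) * (2 * Real.log x)) =
        2 * x ^ η * x ^ (1 - c) * Real.log x := by
      ring
    rw [this, h84]
    rw [h85] at h81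
    have hu : 0 ≤ x / (16 * M) := by positivity
    linarith
  have hfin := div_log_rpow_lt (by positivity : 0 < 4 * K) (by linarith) e4'
  linarith

/-- **Corollary: the `(n, q) = 1` twist.**  For every modulus `0 < q ≤ x²` the exceptional set may
be taken to be the prime divisors of `q`: a comparison sequence needs to put mass `≥ x/(4p)` only
on the multiples of the window primes `p ∤ q`.
[cite: FordMaynard2024PrimeSieves, §4.2 (Lemma 4.6)] -/
theorem eventually_not_typeII_of_sparse_cmp_coprime {c θ ν B η : ℝ} (hθ : 0 ≤ θ) (hη : 0 ≤ η)
    (hθc : θ + η < c) (hc1 : c ≤ 1) (hν : 0 < ν) (hB : 1 < B) :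
    ∀ᶠ x : ℝ in atTop, ∀ (a b : ℕ → ℝ) (A : Finset ℕ) (q : ℕ), (A.card : ℝ) ≤ x ^ (1 - c) →
      (∀ v : ℕ, x / 2 < (v : ℝ) → (v : ℝ) ≤ x → a v ≠ 0 → v ∈ A) →
      (∀ n, 0 ≤ b n) → (∀ n, b n ≤ x ^ η) → 0 < q → (q : ℝ) ≤ x ^ 2 →
      (∀ p : ℕ, p.Prime → ¬ p ∣ q → (x / 2) ^ θ < (p : ℝ) → (p : ℝ) ≤ x ^ (θ + ν) →
        x / (4 * p) ≤ ∑ n ∈ (Icc 1 ⌊x⌋₊).filter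
          (fun n : ℕ => x / 2 < (p * n : ℝ) ∧ (p * n : ℝ) ≤ x), b (p * n)) →
      ¬ TypeII (fun n : ℕ => a n - b n) x θ ν B := by
  filter_upwards [eventually_not_typeII_of_sparse_cmp_except hθ hη hθc hc1 hν hB,
    eventually_ge_atTop (Real.exp 6)] with x hx hx6 a b A q hA hcov hb0 hbη hq hqx hbm
  have hx0 : 0 < x := lt_of_lt_of_le (Real.exp_pos 6) hx6
  have hlx6 : 6 ≤ Real.log x := by
    rw [Real.le_log_iff_exp_le hx0]; exact hx6
  -- exceptional set: the prime divisors of `q`; at most `log(x²)/log(3/2) ≤ 6 log x ≤ (log x)²`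
  refine hx a b A q.primeFactors hA hcov hb0 hbη ?_ ?_
  · have hS : ∀ p ∈ q.primeFactors, p.Prime ∧ (3 / 2 : ℝ) < (p : ℝ) := by
      intro p hp
      have hpr := (Nat.mem_primeFactors.mp hp).1
      have h2 : (2 : ℝ) ≤ p := by exact_mod_cast hpr.two_le
      exact ⟨hpr, by linarith⟩
    have hcard := card_filter_prime_dvd_le (by norm_num : (1 : ℝ) < 3 / 2) hq.ne' hqx hS
    have hfilt : q.primeFactors.filter (fun p => p ∣ q) = q.primeFactors :=
      Finset.filter_true_of_mem (fun p hp => (Nat.mem_primeFactors.mp hp).2.1)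
    rw [hfilt, Real.log_pow] at hcard
    push_cast at hcard
    have hl : (1 : ℝ) / 3 ≤ Real.log (3 / 2) := by
      have h := Real.one_sub_inv_le_log_of_pos (by norm_num : (0 : ℝ) < 3 / 2)
      norm_num at h
      linarith
    have hlpos : 0 < Real.log (3 / 2) := by linarith
    have hlx0 : 0 ≤ Real.log x := by linarith
    have h6 : ((q.primeFactors.card : ℕ) : ℝ) ≤ 6 * Real.log x := by
      refine hcard.trans ?_
      rw [div_le_iff₀ hlpos]
      have := mul_le_mul_of_nonneg_left hl (by positivity : (0 : ℝ) ≤ 6 * Real.log x)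
      linarith
    have h7 : 6 * Real.log x ≤ Real.log x ^ 2 := by
      rw [sq]
      exact mul_le_mul_of_nonneg_right hlx6 hlx0
    exact h6.trans h7
  · intro p hpr hpQ
    exact hbm p hpr (fun hd => hpQ (Nat.mem_primeFactors.mpr ⟨hpr, hd, hq.ne'⟩))
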